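/-
Copyright (c) 2026 the pub-hodgecm-mathlib formalisation cell (harness21).  Prover seat hodgecm-mathlib-R90-C10-p08 (g2), SLAB R90-TF, section S1 «Ch. 10∕12 local», default
hand (D-1) for the cell «U4-RAM» (L4 line-lead K2E3-plan (g5)): the RAMIFIED PROVIDER of the U4Keys socket :155 (depth 0, Branch B) = S1 A2′, crux H413 = `stmt-HodgeConjecture-24833`.
KERNEL module: THEOREMS ONLY (no definition, no named fact, no `sorry`, no instance, no notation).  2026-09-04.
-/
import Summits.HodgeConjecture.HodgeConjecture.Theorems.R90S1KeysThmTwoDepthZeroBranchBRamified        -- ★ p862481 (R90-C10-p05 (g0)): WRAPPER `exists_eta_of_reducible_of_shellIdentities_ram` — :155 at a tame ramified place MODULO `hint hc hscal h1 h0`, (G3)-frame in the binders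
import Summits.HodgeConjecture.HodgeConjecture.Theorems.R90S1BranchBShellScalingRamified               -- ★ p862427 (R90-C10-p01 (g2)) R1: `integral_S_ge_eq_of_uniformizer` = letter `hscal`
import Summits.HodgeConjecture.HodgeConjecture.Theorems.R90S1BranchBShellZeroRamified                  -- ★ p862526 (R90-C10-p01 (g2)) R2: `integral_Sh_zero_eq_ram` = letter `h0`, `chi_neg_two_sq_eq_one_ram` = letter `hc` (`c₀ = χ₁(−2)`)
import Summits.HodgeConjecture.HodgeConjecture.Theorems.R90S1BranchBShellOneRamified                   -- ★ p862795 (R90-C10-p01 (g2)) R3b: `integral_Sh_one_eq_zero_ram` = letter `h1` (the odd shell vanishes; over ★ R3a p862612)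
import Summits.HodgeConjecture.HodgeConjecture.Theorems.R90S1RamifiedDyadicDepthZeroBranchBVacuous      -- ★ p862091 (R90-C10-p05 (g0)): `chi_eq_one_of_mem_unitsIntegers_of_ramified_dyadic` — the WILD (dyadic) ramified corner contradicts `hram`
import Summits.HodgeConjecture.HodgeConjecture.Theorems.K2E3BranchBShellScalingFromWeightSeries         -- ★ p862287 (K2E3-p06 (g5)) (II)-a (a): `integrableOn_F₀_S_ge` = letter `hint` (place-generic, `hunr`-free)
import Summits.HodgeConjecture.HodgeConjecture.Theorems.K2E3KeysThmTwoDepthZeroBranchBInertLeaf          -- ★ p862384 (R90-C10-p04 (g0)) (W-2): the inert twin — brings the (G3)-frame vocabulary (`coe_eA_apply`, `glDiagonal`, `weylLongU`, `cmLocalForm_eq_over`, `locallyCompactSpace_local`, …)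
import Summits.HodgeConjecture.HodgeConjecture.Theorems.F0P3cStCharTSTorusRay                            -- ★ `exists_uniformizer_units` (a unit `Π` of `L ⊗ L⁺_v` with `|Π_w′| = exp(−1)` at every `w′ ∣ v`)
import Literature.NumberTheory.Automorphic.Liu2021.LemD1AsPrintedIndexedNonVacuityTameSynthesis          -- ★ `isUnramifiedIn_of_ramificationIdx'_eq_one` (non-split: `e(w|v) = 1 ⇒` Mathlib-unramified) — reads the guard `¬ IsUnramifiedIn`
import HarnessLib

/-!
# R90 · S1 ∕ U4Keys leaf (U4f-χ₁-ram-one-d0B) — THE SOCKET :155 AT A RAMIFIED PLACE — THE RAMIFIED PROVIDER (frame-free, no shell letter left)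
# `i(χ₁, 1)` reducible (χ₁ continuous, non-unitary, contracting, depth zero, Branch B, ramified; `v` non-split and RAMIFIED in `L`) ⟹ `χ₁ = η · ‖·‖^{1∕2}`, `η` a quadratic character extension
# [Keys1984 §3, §7 Thm (2) (d); Casselman1980 §3; Casselman1995 §6.4, Thm. 6.6.2; Rogawski1990 §12.1–§12.2; Roche1998 §3–§4; Serre, Corps locaux IV §1–§2]

Cell `pub/hodgecm-mathlib` (D-0151), SLAB R90-TF, section S1 «Ch. 10∕12 local», crux H413 = `stmt-HodgeConjecture-24833` (lane `--supports … --as helper`), route of record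
`HCCMUnconditional` (no route verbs); prover seat `hodgecm-mathlib-R90-C10-p08` (g2), default hand (D-1) = the RAMIFIED PROVIDER of :155 for the cell «U4-RAM» (dealer K2E3-plan
(g5), ROUND 4b record: «ramified provider EXACTLY :155 letters + `¬ Algebra.IsUnramifiedIn (𝓞 L) v.asIdeal`»; R90-C10-audit1 (g2) JUNCTION PRE-READ 22:58:13Z (a)–(e)).  THEOREMS ONLY
(no `def`, no `instance`, no notation, no named-fact hypothesis, no `sorry`); ★-only imports (no `Lines` import).  The RAMIFIED twin of ★ (W-2)+(II)-b3
`K2E3KeysThmTwoDepthZeroBranchBInertOddLeaf.exists_eta_of_reducible_inert_odd`.  NOT THE PAYER OF THE LINES SOCKET: :155 quantifies over every non-split `v`; this is its RAMIFIED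
case in full (binders = :155's letters in :155's order + the selector `hrf`, conclusion = :155's second disjunct byte-identically; the assembler does `Or.inr`); the inert odd case is ★
`…InertOddLeaf`, the inert dyadic case is K2E3-p32 (g2)'s `…InertAll` chain.

THE POINT.  ★ p862481 (R90-C10-p05 (g0)) reduced :155 at a tame ramified place to five letters `hint hc hscal h1 h0` over the (G3)-EXPLICIT frame `(w hw eA heA ϖ hϖ g₁ hg₁ K0 K1 I hK0
hK1 hI w₀ hw₀ μ)` and a uniformiser unit `(piU hpiU)`; R90-C10-p01 (g2) paid the three ramified shell letters directly on `N(L⁺_v)` (★ R1 p862427 `hscal`, ★ R2 p862526 `h0`+`hc`, ★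
R3b p862795 `h1`) and K2E3-p06 (g5) the integrability (★ p862287 §3 `hint`).  This module DISCHARGES EVERYTHING: the guard `¬ IsUnramifiedIn` is read at the unique place `w ∣ v` as
`e(w|v) ≠ 1` (★ `isUnramifiedIn_of_ramificationIdx'_eq_one`); the WILD corner `|2|_w < 1` is VACUOUS (★ `chi_eq_one_of_mem_unitsIntegers_of_ramified_dyadic`: `hdepth ∧ hB` force `χ₁ = 1`
on `𝒪ˣ`, against `hram`); at `|2|_w = 1` the frame is built exactly as ★ (W-2) builds it (a uniformiser `ϖ`, `g₁ = diag(1,1,ϖ)`, `eA =` ★ `localNonsplitEquiv` on `Φ₃`, `K0 ∕ K1 ∕ I` by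
`rfl`, `w₀ = eA⁻¹(w_long)` with matrix `Φ₃`), `μ := Measure.haar` on the Borel σ-algebra of the closed subgroup `N(L⁺_v)`, `Π` ★ `exists_uniformizer_units`, `2` invertible in `∏_{w∣v} L_w`
(characteristic `0` — NOT a statement binder), `|X| < 1` ★ `norm_apply_norm_uniformizer_lt_one`, then the five letters BY NAME into ★ `exists_eta_of_reducible_of_shellIdentities_ram`.
* **`exists_eta_of_reducible_ramified`** — :155's second disjunct at every RAMIFIED non-split place, outright.
THE :155 TIE (dealer's pen, R90-C10-p04 (g0) PROBE 2 shape): `by_cases hunr : Algebra.IsUnramifiedIn (𝓞 L) v.asIdeal` → [`by_cases ∀ w, |2|_w = 1` → `Or.inr (…InertOddLeaf… )` ∣ dyadic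
`…InertAll…`] ∣ `Or.inr (R90.S1.exists_eta_of_reducible_ramified L v hns hunr χ₁ h₁ hnu hcontr hram hdepth hB hred)`.
HONEST LABEL.  HC_CM is proved only modulo the 7 printed citations (2 remaining named inputs: hLiu418 = `stmt-HodgeConjecture-24832`, h413 = `stmt-HodgeConjecture-24833`) until rung 0
closes; count-neutral — this file does NOT pay :155 (the Lines socket stays OPEN until the dyadic-inert provider lands and the dealer ties it); no printed citation is discharged.

## References
* [Keys1984] D. Keys, *Principal series representations of special unitary groups over local fields*, Compositio Math. 51 (1984), §3, §7 Theorem (2) (d) p. 126.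
* [Casselman1980] W. Casselman, *The unramified principal series of p-adic groups I*, Compositio Math. 40 (1980), §3.
* [Casselman1995] W. Casselman, *Introduction to the theory of admissible representations of `p`-adic reductive groups* (1995), §6.4, Thm. 6.6.2.
* [Rogawski1990] J. D. Rogawski, *Automorphic Representations of Unitary Groups in Three Variables*, Ann. of Math. Stud. 123 (1990), §12.1 p. 171, §12.2 (1)–(2) p. 173.
* [Roche1998] A. Roche, *Types and Hecke algebras for principal series representations of split reductive p-adic groups*, Ann. Sci. ÉNS (4) 31 (1998), §3–§4.
* [Serre1979] J.-P. Serre, *Local Fields*, GTM 67 (1979), Ch. IV §1–§2.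
-/

set_option autoImplicit false
-- the mandated namespace has the single-problem summit's repeated segment (`HodgeConjecture.HodgeConjecture`)
set_option linter.dupNamespace false

noncomputable section

open NumberField IsDedekindDomain MeasureTheory
open scoped Matrix MatrixGroups WithZero Valued NNReal
open Literature.NumberTheory Literature.NumberTheory.Automorphic Literature.NumberTheory.Automorphic.UnitaryGroup
open Literature.NumberTheory.Rogawski1990
open Literature.NumberTheory.Automorphic.Liu2021.LemD1IndexedNonVacuityTameSynthesis (isUnramifiedIn_of_ramificationIdx'_eq_one)

namespace Summit.HodgeConjecture.HodgeConjecture.R90.S1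

open Summit.HodgeConjecture.HodgeConjecture.Cruxes.H413
open Summit.HodgeConjecture.HodgeConjecture.Cruxes.H413.K2E3DepthZeroIwahoriCharacterCM
open Summit.HodgeConjecture.HodgeConjecture.Cruxes.H413.K2E3BranchATorusWitnessCM

variable (L : Type) [Field L] [NumberField L] [IsCMField L] (v : HeightOneSpectrum (𝓞 ↥(maximalRealSubfield L)))

/-! ## :155 at a ramified place — the provider -/

open Classical in
set_option maxHeartbeats 4000000 in
set_option synthInstance.maxHeartbeats 400000 in
-- ★ p05's closing composition instantiated: the guard read at `w`, the wild corner vacuous, the (G3) frame (★ (W-2) pattern), `μ := Measure.haar`, `Π`, `2⁻¹`, the five letters ★ by name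
/-- **THE SOCKET :155 AT A RAMIFIED PLACE — PAID (the ramified provider).**  `v` non-split (`hns`) and RAMIFIED in `L` (`hrf : ¬ IsUnramifiedIn`); `χ₁ : (L ⊗ L⁺_v)ˣ → ℂˣ` continuous,
non-unitary (`∃ x, |χ₁ x| ≠ 1`), contracting, NOT trivial on the integral units (`hram`), trivial on the principal units (depth zero), `χ₁(u·σu) = 1` on the units of valuation one (Branch
B).  If `i(χ₁, 1)` is reducible then **`χ₁ = η · ‖·‖^{1∕2}` for a continuous quadratic character extension `η`** — the second disjunct of :155 (Keys' cases (b)–(d) at a ramified place; the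
first disjunct, Keys (a), is Branch A ∕ unramified `χ₁`).  Proof: `e(w|v) ≠ 1` at the unique `w ∣ v` (★ `isUnramifiedIn_of_ramificationIdx'_eq_one`); if `|2|_w < 1` then ★
`chi_eq_one_of_mem_unitsIntegers_of_ramified_dyadic` contradicts `hram`; else the (G3)-explicit frame of ★ (W-2) (uniformiser, `g₁ = diag(1,1,ϖ)`, `eA =` ★ `localNonsplitEquiv`, `w₀ =
eA⁻¹(w_long)` with matrix `Φ₃`), `μ := Measure.haar` on the Borel σ-algebra of `N(L⁺_v)`, `Π` ★ `exists_uniformizer_units`, `2` invertible, `|X| < 1` ★ `norm_apply_norm_uniformizer_lt_one`,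
`hint` ★ `integrableOn_F₀_S_ge`, `hscal` ★ R1 `integral_S_ge_eq_of_uniformizer`, `h0` ★ R2 `integral_Sh_zero_eq_ram` (`c₀ = χ₁(−2)`), `hc` ★ R2 `chi_neg_two_sq_eq_one_ram`, `h1` ★ R3b
`integral_Sh_one_eq_zero_ram`, then ★ `exists_eta_of_reducible_of_shellIdentities_ram`. [cite: Keys1984, §3, §7 Theorem (2) (d) p. 126] [cite: Casselman1980, §3]
[cite: Casselman1995, §6.4, Thm. 6.6.2] [cite: Rogawski1990, §12.2 (1)–(2) p. 173] [cite: Roche1998, §3–§4] [cite: Serre1979, Ch. IV §1 Prop. 4, §2] -/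
theorem exists_eta_of_reducible_ramified
    (hns : ∀ w' : PlacesOver L v, IsCMField.complexConj L • w'.1 = w'.1) (hrf : ¬ Algebra.IsUnramifiedIn (𝓞 L) v.asIdeal)
    (χ₁ : (LocalRing L v)ˣ →* ℂˣ) (h₁ : Continuous fun x => ((χ₁ x : ℂˣ) : ℂ)) (hnu : ∃ x, ‖((χ₁ x : ℂˣ) : ℂ)‖ ≠ 1)
    (hcontr : ∀ x : (LocalRing L v)ˣ, unitModulusChar (LocalRing L v) x < 1 → ‖((χ₁ x : ℂˣ) : ℂ)‖ < 1)
    (hram : ¬ (∀ u ∈ (Submonoid.pi Set.univ (fun w : PlacesOver L v => (w.1.adicCompletionIntegers L).toSubring.toSubmonoid)).units, χ₁ u = 1))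
    (hdepth : ∀ u : (LocalRing L v)ˣ, (∀ w' : PlacesOver L v, Valued.v (((u : LocalRing L v) w') - 1) < 1) → χ₁ u = 1)
    (hB : ∀ u : (LocalRing L v)ˣ, (∀ w' : PlacesOver L v, Valued.v ((u : LocalRing L v) w') = 1) →
      χ₁ (u * Units.map (conjLocal L (IsCMField.complexConj L) v : LocalRing L v →* LocalRing L v) u) = 1)
    (hred : ∃ N : Subrepresentation (cmPrincipalSeries L 3 v (cmTorusCharPair L v χ₁ 1)), N ≠ ⊥ ∧ N ≠ ⊤) :
    ∃ η : (LocalRing L v)ˣ →* ℂˣ, IsQuadraticCharExtension (conjLocal L (IsCMField.complexConj L) v) η ∧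
      Continuous (fun x => ((η x : ℂˣ) : ℂ)) ∧ χ₁ = η * halfModulusChar (LocalRing L v) := by
  obtain ⟨w⟩ : Nonempty (PlacesOver L v) := inferInstance
  have hw : IsCMField.complexConj L • w.1 = w.1 := hns w
  -- the guard `¬ IsUnramifiedIn` read at the unique place `w ∣ v`: `e(w|v) ≠ 1`
  have he : v.asIdeal.ramificationIdx' w.1.asIdeal ≠ 1 := by
    intro he1
    haveI : Algebra.IsQuadraticExtension ↥(maximalRealSubfield L) L := IsCMField.isQuadraticExtension L
    exact hrf (isUnramifiedIn_of_ramificationIdx'_eq_one L (IsCMField.complexConj L) v (IsCMField.complexConj_ne_one L) w hw he1)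
  -- the WILD corner `|2|_w < 1` is vacuous: `hdepth ∧ hB ⟹ χ₁ = 1` on the integral units, against `hram`
  by_cases h2w : Valued.v (2 : w.1.adicCompletion L) = 1
  swap
  · have h2le : Valued.v (2 : w.1.adicCompletion L) ≤ 1 := by
      have h11 : (2 : w.1.adicCompletion L) = 1 + 1 := by norm_num
      rw [h11]
      exact (Valuation.map_add _ _ _).trans (by rw [Valuation.map_one, max_self])
    exact absurd (chi_eq_one_of_mem_unitsIntegers_of_ramified_dyadic L v w hw he (lt_of_le_of_ne h2le h2w) χ₁ hdepth hB) hram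
  -- TAME (`|2|_w = 1`): the (G3)-EXPLICIT frame letters (★ (W-2) ∕ Z2A-6 pattern): a uniformiser, `g₁ = diag(1,1,ϖ)`, `eA =` ★ `localNonsplitEquiv` on `Φ₃`
  obtain ⟨ϖ, hϖ⟩ : ∃ τ : w.1.adicCompletion L, Valued.v τ = WithZero.exp (-1 : ℤ) := by
    obtain ⟨π, hπ⟩ := w.1.valuation_exists_uniformizer L
    exact ⟨(π : w.1.adicCompletion L), by rw [HeightOneSpectrum.valuedAdicCompletion_eq_valuation', hπ]⟩
  have hϖ0 : ϖ ≠ 0 := fun h0 => by rw [h0, map_zero] at hϖ; exact WithZero.zero_ne_coe hϖ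
  obtain ⟨g₁, hg₁⟩ : ∃ g₁ : GL (Fin 3) (w.1.adicCompletion L), (g₁ : Matrix (Fin 3) (Fin 3) (w.1.adicCompletion L)) = Matrix.diagonal ![(1 : w.1.adicCompletion L), 1, ϖ] := by
    refine ⟨glDiagonal 3 (w.1.adicCompletion L) ![1, 1, Units.mk0 ϖ hϖ0], ?_⟩
    rw [coe_glDiagonal]
    congr 1
    funext i
    fin_cases i <;> rfl
  have hJw : placeForm (qsForm L) w.1 = (StdForm.antidiagonal 3).over (w.1.adicCompletion L) := by
    rw [placeForm, qsForm, antidiagOne_eq_over, StdForm.over_map]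
  obtain ⟨eA, heA⟩ : ∃ eA : Gqs L v ≃ₜ* ↥(unitaryGroupOfForm (galAdicCompletionMap (L := L) (IsCMField.complexConj L) hw) ((StdForm.antidiagonal 3).over (w.1.adicCompletion L))),
      ∀ g : Gqs L v, ((eA g : ↥(unitaryGroupOfForm (galAdicCompletionMap (L := L) (IsCMField.complexConj L) hw) ((StdForm.antidiagonal 3).over (w.1.adicCompletion L)))) :
          GL (Fin 3) (w.1.adicCompletion L)) =
        ((localNonsplitEquiv (IsCMField.complexConj L) (qsForm L) (IsCMField.complexConj_ne_one L) w hw g :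
          ↥(unitaryGroupOfForm (galAdicCompletionMap (L := L) (IsCMField.complexConj L) hw) (placeForm (qsForm L) w.1))) : GL (Fin 3) (w.1.adicCompletion L)) := by
    rw [← hJw]
    exact ⟨localNonsplitEquiv (IsCMField.complexConj L) (qsForm L) (IsCMField.complexConj_ne_one L) w hw, fun g => rfl⟩
  -- `w₀ = eA⁻¹(w_long)` has matrix `Φ₃`
  have hw₀ : Units.val ((eA.symm (weylLongU (galAdicCompletionMap (L := L) (IsCMField.complexConj L) hw)
      (rfl : (StdForm.antidiagonal 3).over (w.1.adicCompletion L) = _))).val : GL (Fin 3) (LocalRing L v)) = cmLocalForm L 3 v := by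
    refine Matrix.ext fun i j => ?_
    rw [LocalRing.eq_iff_apply_eq (IsCMField.complexConj L) (IsCMField.complexConj_ne_one L) w hw,
      ← coe_eA_apply L v w hw eA heA (eA.symm (weylLongU (galAdicCompletionMap (L := L) (IsCMField.complexConj L) hw) rfl)) i j,
      ContinuousMulEquiv.apply_symm_apply, coe_coe_weylLongU, cmLocalForm_eq_over]
    have h := congr_fun (congr_fun ((StdForm.antidiagonal 3).over_map (Pi.evalRingHom (fun w' : PlacesOver L v => w'.1.adicCompletion L) w)) i) j
    rw [Matrix.map_apply, Pi.evalRingHom_apply] at h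
    exact h.symm
  -- the Haar measure of the closed subgroup `N(L⁺_v)` on its Borel σ-algebra
  letI : MeasurableSpace ↥(cmBorelTriple L 3 v).N := borel _
  haveI : BorelSpace ↥(cmBorelTriple L 3 v).N := ⟨rfl⟩
  haveI : LocallyCompactSpace ↥(unitaryGroupOfForm (conjLocal L (IsCMField.complexConj L) v) (cmLocalForm L 3 v)) :=
    locallyCompactSpace_local (IsCMField.complexConj L) 3 _ v
  haveI : LocallyCompactSpace ↥(cmBorelTriple L 3 v).N :=
    (LineRing.isClosed_unipotentU (conjLocal L (IsCMField.complexConj L) v) (cmLocalForm L 3 v)).isClosedEmbedding_subtypeVal.locallyCompactSpace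
  -- `2` is invertible in `∏_{w ∣ v} L_w` (characteristic `0`); the sign `c₀ := χ₁(−2)`, `c₀² = 1` (★ R2)
  haveI : Invertible (2 : LocalRing L v) :=
    (isUnit_iff_exists_inv.2 ⟨fun w' => (2 : w'.1.adicCompletion L)⁻¹, funext fun _ => mul_inv_cancel₀ two_ne_zero⟩ : IsUnit (2 : LocalRing L v)).invertible
  have hc := chi_neg_two_sq_eq_one_ram L v w hw h2w χ₁ hB
  -- a uniformiser unit `Π` of `L ⊗ L⁺_v` and `|X| < 1`, `X = χ₁(σΠ·Π)` (contraction)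
  obtain ⟨piU, hpiU⟩ := F0P3cStCharTSTorusRay.exists_uniformizer_units L v
  have hX := norm_apply_norm_uniformizer_lt_one L v hns w hw piU hpiU χ₁ hcontr
  -- the five letters BY NAME: `hint` ★ (II)-a, `hscal` ★ R1, `h0` ★ R2, `h1` ★ R3b
  have hint := K2E3BranchBShellScalingFromWeightSeries.integrableOn_F₀_S_ge L v w hw hns χ₁ h₁ hcontr (Measure.haar : Measure ↥(cmBorelTriple L 3 v).N)
  have hscal := integral_S_ge_eq_of_uniformizer L v w hw hns piU hpiU χ₁ (Measure.haar : Measure ↥(cmBorelTriple L 3 v).N) hX hint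
  have h0 := integral_Sh_zero_eq_ram L v w hw he h2w χ₁ hdepth hB (Measure.haar : Measure ↥(cmBorelTriple L 3 v).N)
  have h1 := integral_Sh_one_eq_zero_ram L v w hw he h2w χ₁ h₁ hdepth hram (Measure.haar : Measure ↥(cmBorelTriple L 3 v).N)
  exact exists_eta_of_reducible_of_shellIdentities_ram L v w hw eA heA hϖ g₁ hg₁ _ _ _ rfl rfl rfl
    (eA.symm (weylLongU (galAdicCompletionMap (L := L) (IsCMField.complexConj L) hw) (rfl : (StdForm.antidiagonal 3).over (w.1.adicCompletion L) = _)))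
    hw₀ hns he h2w piU hpiU χ₁ h₁ hnu hcontr hdepth hB hram Measure.haar hint _ hc hscal h1 h0 hred

end Summit.HodgeConjecture.HodgeConjecture.R90.S1

end
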